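import Mathlib
import Summits.PneNP.PneNP.Theorems.OverlapGapAlgebraStableSectionEasyRegime
import Summits.PneNP.PneNP.Theorems.OverlapGapAlgebraSolvableImpliesStableSectionEngine
import Summits.PneNP.PneNP.Theorems.OverlapGapAlgebraSolvableImpliesStableSectionAsymptotics

/-!
# Route OverlapGapAlgebra, crux `SolvableImpliesStableSection` (stmt-PneNP-2463), line `Sketch`:
# calibration — the CONSTANT section realises the crux's conclusion whenever `ν > 2^{-k}`

`conclusion_const_section`: for every `k ≥ 1`, `α > 0`, `η > 0`, `ν > 2^{-k}`, `c > 0` and all large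
`n` (`m = ⌊α n⌋₊`), the constant all-`true` assignment map is `ν`-valid at every splice point of the
Bresler–Huang path and (trivially) `ηn`-stable, on at least an `e^{-cn}` fraction of the path tuples —
the event of `NoStableSection` / the conclusion of `SolvableImpliesStableSection`, verbatim. Hence the
crux restricted to `ν > 2^{-k}` holds outright (`solvableImpliesStableSection_of_nu_gt`, hypothesis
unused), for ALL `k` (the typed `StableSectionEasyRegime` needed `k ≥ k₀(ν)`): the contentful regime of
both cruxes is `ν ≤ 2^{-k}` (crux notes B2, now a theorem). Proof: the engine `engine_count` with
`G = {≤ ν m all-negative clauses}`; Chebyshev in counting form (`cs_density`, from the second moment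
`cs_sum_sq`/`cs_sum_var` of the number of clauses in a fixed clause set, pair fibre count
`cs_card_fiber2`) gives `(k m)·#Gᶜ ≤ k 2^{-k}(1-2^{-k})/(ν-2^{-k})² · #instances`; jumps are zero;
`stub_asymptotics` compares with `e^{-cn}`.
-/

set_option linter.dupNamespace false -- `Summit.PneNP.PneNP.…`: summit = sub-problem (D-0017)

namespace Summit.PneNP.PneNP.Cruxes.SolvableImpliesStableSection.Sketch

open Finset
open scoped Classical

/-! ## Calibration: the constant section (conclusion of the crux for `ν > 2^{-k}`, unconditionally) -/

section ConstSection

/-- Pair fibre count on a product space: for `i ≠ i'`,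
`#{f : ι → C | f i ∈ B ∧ f i' ∈ B} = #B · #B · #C ^ (#ι - 2)`. -/
theorem cs_card_fiber2 {ι C : Type*} [Fintype ι] [DecidableEq ι] [Fintype C] [DecidableEq C]
    (B : Finset C) {i i' : ι} (h : i ≠ i') :
    ((univ : Finset (ι → C)).filter fun f => f i ∈ B ∧ f i' ∈ B).card
      = B.card * B.card * Fintype.card C ^ (Fintype.card ι - 2) := by
  have h1 := Fintype.piFinset_update_eq_filter_piFinset_mem
    (fun _ : ι => (univ : Finset C)) i (t := B) (Finset.subset_univ _)
  have h2 := Fintype.piFinset_update_eq_filter_piFinset_mem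
    (Function.update (fun _ : ι => (univ : Finset C)) i B) i' (t := B)
    (by rw [Function.update_of_ne h.symm]; exact Finset.subset_univ _)
  rw [h1, Fintype.piFinset_univ, Finset.filter_filter] at h2
  rw [← h2, Fintype.card_piFinset, ← Finset.mul_prod_erase univ _ (mem_univ i),
    ← Finset.mul_prod_erase (univ.erase i) _ (Finset.mem_erase.2 ⟨h.symm, mem_univ i'⟩)]
  have hi : (Function.update (Function.update (fun _ : ι => (univ : Finset C)) i B) i' B i).card
      = B.card := by rw [Function.update_of_ne h, Function.update_self]
  have hi' : (Function.update (Function.update (fun _ : ι => (univ : Finset C)) i B) i' B i').card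
      = B.card := by rw [Function.update_self]
  have hrest : ∀ j ∈ (univ.erase i).erase i',
      (Function.update (Function.update (fun _ : ι => (univ : Finset C)) i B) i' B j).card
        = Fintype.card C := by
    intro j hj
    have hj' : j ≠ i' := Finset.ne_of_mem_erase hj
    have hj'' : j ≠ i := Finset.ne_of_mem_erase (Finset.mem_of_mem_erase hj)
    rw [Function.update_of_ne hj', Function.update_of_ne hj'', Finset.card_univ]
  rw [hi, hi', Finset.prod_congr rfl hrest, Finset.prod_const, Finset.card_erase_of_mem
    (Finset.mem_erase.2 ⟨h.symm, mem_univ i'⟩), Finset.card_erase_of_mem (mem_univ i),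
    Finset.card_univ, mul_assoc]
  congr 1

/-- Single fibre count (as in `ssER_card_fiber`): `#{f : ι → C | f i ∈ B} = #B · #C ^ (#ι - 1)`. -/
theorem cs_card_fiber1 {ι C : Type*} [Fintype ι] [DecidableEq ι] [Fintype C] [DecidableEq C]
    (B : Finset C) (i : ι) :
    ((univ : Finset (ι → C)).filter fun f => f i ∈ B).card
      = B.card * Fintype.card C ^ (Fintype.card ι - 1) := by
  have h := Fintype.piFinset_update_eq_filter_piFinset_mem
    (fun _ : ι => (univ : Finset C)) i (t := B) (Finset.subset_univ _)
  rw [Fintype.piFinset_univ] at h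
  rw [← h, Fintype.card_piFinset, ← Finset.mul_prod_erase univ _ (mem_univ i), Function.update_self]
  have hc : ∀ j ∈ univ.erase i,
      (Function.update (fun _ : ι => (univ : Finset C)) i B j).card = Fintype.card C := by
    intro j hj
    rw [Function.update_of_ne (Finset.ne_of_mem_erase hj), Finset.card_univ]
  rw [Finset.prod_congr rfl hc, Finset.prod_const, Finset.card_erase_of_mem (mem_univ i),
    Finset.card_univ]

/-- Second moment of the number `W Φ` of clauses of `Φ` lying in a fixed clause set `B`:
`∑_Φ (W Φ)² = m·#B·#C^(m-1) + m(m-1)·#B²·#C^(m-2)` (diagonal + off-diagonal fibre counts). -/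
theorem cs_sum_sq {C : Type*} [Fintype C] [DecidableEq C] (m : ℕ) (B : Finset C) :
    ∑ Φ : Fin m → C, ((univ : Finset (Fin m)).filter fun i => Φ i ∈ B).card ^ 2
      = m * (B.card * Fintype.card C ^ (m - 1))
        + m * (m - 1) * (B.card * B.card * Fintype.card C ^ (m - 2)) := by
  have hW : ∀ Φ : Fin m → C, ((univ : Finset (Fin m)).filter fun i => Φ i ∈ B).card
      = ∑ i, if Φ i ∈ B then 1 else 0 := fun Φ => by rw [Finset.card_filter]
  simp_rw [hW, sq, Finset.sum_mul_sum]
  rw [Finset.sum_comm]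
  have hinner : ∀ i : Fin m, ∑ Φ : Fin m → C, ∑ i', (if Φ i ∈ B then 1 else 0) * (if Φ i' ∈ B then 1 else 0)
      = B.card * Fintype.card C ^ (m - 1) + (m - 1) * (B.card * B.card * Fintype.card C ^ (m - 2)) := by
    intro i
    rw [Finset.sum_comm]
    have hpair : ∀ i' : Fin m, ∑ Φ : Fin m → C, (if Φ i ∈ B then 1 else 0) * (if Φ i' ∈ B then 1 else 0)
        = ((univ : Finset (Fin m → C)).filter fun Φ => Φ i ∈ B ∧ Φ i' ∈ B).card := by
      intro i'
      rw [Finset.card_filter]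
      refine Finset.sum_congr rfl fun Φ _ => ?_
      by_cases h1 : Φ i ∈ B <;> by_cases h2 : Φ i' ∈ B <;> simp [h1, h2]
    simp_rw [hpair]
    rw [← Finset.add_sum_erase univ _ (mem_univ i)]
    congr 1
    · rw [show ((univ : Finset (Fin m → C)).filter fun Φ => Φ i ∈ B ∧ Φ i ∈ B)
          = (univ.filter fun Φ => Φ i ∈ B) by simp only [and_self], cs_card_fiber1, Fintype.card_fin]
    · rw [Finset.sum_congr rfl fun i' hi' => cs_card_fiber2 B (Finset.ne_of_mem_erase hi').symm,
        Finset.sum_const, smul_eq_mul, Finset.card_erase_of_mem (mem_univ i), Finset.card_univ,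
        Fintype.card_fin]
  simp_rw [hinner]
  rw [Finset.sum_const, smul_eq_mul, Finset.card_univ, Fintype.card_fin]
  ring

/-- First moment: `∑_Φ W Φ = m·#B·#C^(m-1)`. -/
theorem cs_sum_one {C : Type*} [Fintype C] [DecidableEq C] (m : ℕ) (B : Finset C) :
    ∑ Φ : Fin m → C, ((univ : Finset (Fin m)).filter fun i => Φ i ∈ B).card
      = m * (B.card * Fintype.card C ^ (m - 1)) := by
  simp_rw [Finset.card_filter]
  rw [Finset.sum_comm]
  simp_rw [← Finset.card_filter, cs_card_fiber1, Fintype.card_fin]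
  rw [Finset.sum_const, smul_eq_mul, Finset.card_univ, Fintype.card_fin]

/-- Variance (Bienaymé for the `m` independent clause indicators), counting form: with `N = #C^m` and
`p = #B/#C`, `∑_Φ (W Φ - m p)² = N · m · p (1 - p)` for `m ≥ 1` and `#C > 0`. -/
theorem cs_sum_var {C : Type*} [Fintype C] [DecidableEq C] (m : ℕ) (hm : 1 ≤ m) (B : Finset C)
    (hC : 0 < Fintype.card C) :
    ∑ Φ : Fin m → C, ((((univ : Finset (Fin m)).filter fun i => Φ i ∈ B).card : ℝ)
        - m * (B.card / Fintype.card C)) ^ 2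
      = (Fintype.card C : ℝ) ^ m * m * ((B.card : ℝ) / Fintype.card C) * (1 - B.card / Fintype.card C) := by
  have h2 : (∑ Φ : Fin m → C, ((((univ : Finset (Fin m)).filter fun i => Φ i ∈ B).card : ℝ)) ^ 2)
      = m * ((B.card : ℝ) * (Fintype.card C : ℝ) ^ (m - 1))
        + m * ((m : ℝ) - 1) * ((B.card : ℝ) * B.card * (Fintype.card C : ℝ) ^ (m - 2)) := by
    have := cs_sum_sq m B
    have hm1 : ((m - 1 : ℕ) : ℝ) = (m : ℝ) - 1 := by rw [Nat.cast_sub hm, Nat.cast_one]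
    rw [← hm1]
    exact_mod_cast this
  have h1 : (∑ Φ : Fin m → C, ((((univ : Finset (Fin m)).filter fun i => Φ i ∈ B).card : ℝ)))
      = m * ((B.card : ℝ) * (Fintype.card C : ℝ) ^ (m - 1)) := by exact_mod_cast cs_sum_one m B
  set c : ℝ := (Fintype.card C : ℝ) with hc
  set b : ℝ := (B.card : ℝ) with hb
  have hc0 : c ≠ 0 := by rw [hc]; exact_mod_cast hC.ne'
  have hexp : ∀ x : ℝ, (x - m * (b / c)) ^ 2 = x ^ 2 - 2 * (m * (b / c)) * x + (m * (b / c)) ^ 2 :=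
    fun x => by ring
  simp_rw [hexp]
  rw [Finset.sum_add_distrib, Finset.sum_sub_distrib, ← Finset.mul_sum, h2, h1, Finset.sum_const,
    Finset.card_univ, Fintype.card_fun, Fintype.card_fin, nsmul_eq_mul]
  push_cast
  rw [← hc]
  -- powers of `c`: `c^(m-1) = c^m / c`, and the off-diagonal term
  have hpow1 : c ^ (m - 1) = c ^ m / c := by
    rw [eq_div_iff hc0, ← pow_succ, Nat.sub_add_cancel hm]
  rcases Nat.lt_or_ge m 2 with hlt | hge
  · have hm1 : m = 1 := by omega
    subst hm1
    simp
    field_simp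
    ring
  · have hpow2 : c ^ (m - 2) = c ^ m / (c * c) := by
      rw [eq_div_iff (mul_ne_zero hc0 hc0), show c ^ (m - 2) * (c * c) = c ^ (m - 2 + 2) by ring,
        Nat.sub_add_cancel hge]
    rw [hpow1, hpow2]
    field_simp
    ring

/-- Chebyshev, counting form: for `#C > 0` and `ν > p = #B/#C`,
`(k·m) · #{Φ : ¬ (W Φ ≤ ν m)} ≤ (k p (1-p) / (ν-p)²) · #C^m`. -/
theorem cs_density {C : Type*} [Fintype C] [DecidableEq C] (k m : ℕ) (B : Finset C)
    (hC : 0 < Fintype.card C) (ν : ℝ) (hν : (B.card : ℝ) / Fintype.card C < ν) :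
    ((k * m : ℕ) : ℝ) * (((univ : Finset (Fin m → C)).filter fun Φ =>
        ¬ ((((univ : Finset (Fin m)).filter fun i => Φ i ∈ B).card : ℝ) ≤ ν * m)).card : ℝ)
      ≤ k * (((B.card : ℝ) / Fintype.card C) * (1 - B.card / Fintype.card C)
          / (ν - B.card / Fintype.card C) ^ 2) * (Fintype.card C : ℝ) ^ m := by
  have hCR : (0 : ℝ) < Fintype.card C := by exact_mod_cast hC
  have hBC : (B.card : ℝ) ≤ Fintype.card C := by exact_mod_cast Finset.card_le_univ B
  rcases Nat.eq_zero_or_pos m with hm0 | hm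
  · have hq1 : (B.card : ℝ) / Fintype.card C ≤ 1 := (div_le_one hCR).2 hBC
    have hle : ((k * m : ℕ) : ℝ) * (((univ : Finset (Fin m → C)).filter fun Φ =>
        ¬ ((((univ : Finset (Fin m)).filter fun i => Φ i ∈ B).card : ℝ) ≤ ν * m)).card : ℝ) = 0 := by
      rw [hm0, mul_zero, Nat.cast_zero, zero_mul]
    rw [hle]
    exact mul_nonneg (mul_nonneg (Nat.cast_nonneg k)
      (div_nonneg (mul_nonneg (by positivity) (by linarith)) (sq_nonneg _))) (by positivity)
  have hvar := cs_sum_var m hm B hC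
  set q : ℝ := (B.card : ℝ) / Fintype.card C with hq
  set cm : ℝ := (Fintype.card C : ℝ) ^ m with hcm
  have hq0 : 0 ≤ q := by positivity
  have hq1 : q ≤ 1 := (div_le_one hCR).2 hBC
  have hνq : 0 < ν - q := by linarith
  have hmR : (0 : ℝ) < m := by exact_mod_cast hm
  -- Chebyshev: `((ν - q) m)² · #bad ≤ ∑_Φ (W Φ - m q)² = #C^m · m · q (1 - q)`
  set bad := (univ : Finset (Fin m → C)).filter fun Φ =>
    ¬ ((((univ : Finset (Fin m)).filter fun i => Φ i ∈ B).card : ℝ) ≤ ν * m) with hbad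
  have hcheb : ((ν - q) * m) ^ 2 * (bad.card : ℝ) ≤ cm * m * q * (1 - q) := by
    rw [← hvar]
    have s1 : ((ν - q) * m) ^ 2 * (bad.card : ℝ) = ∑ Φ ∈ bad, ((ν - q) * m) ^ 2 := by
      rw [Finset.sum_const, nsmul_eq_mul, mul_comm]
    have s2 : ∑ Φ ∈ bad, ((ν - q) * (m : ℝ)) ^ 2
        ≤ ∑ Φ ∈ bad, ((((univ : Finset (Fin m)).filter fun i => Φ i ∈ B).card : ℝ) - m * q) ^ 2 := by
      refine Finset.sum_le_sum fun Φ hΦ => ?_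
      have hlt : ν * m < (((univ : Finset (Fin m)).filter fun i => Φ i ∈ B).card : ℝ) :=
        not_le.1 (Finset.mem_filter.1 hΦ).2
      have h0 : 0 ≤ (ν - q) * m := by positivity
      exact pow_le_pow_left₀ h0 (by linarith) 2
    have s3 : ∑ Φ ∈ bad, ((((univ : Finset (Fin m)).filter fun i => Φ i ∈ B).card : ℝ) - m * q) ^ 2
        ≤ ∑ Φ : Fin m → C, ((((univ : Finset (Fin m)).filter fun i => Φ i ∈ B).card : ℝ) - m * q) ^ 2 :=
      Finset.sum_le_univ_sum_of_nonneg fun Φ => sq_nonneg _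
    rw [s1]
    exact s2.trans s3
  -- rearrange: `k m #bad ≤ k q(1-q)/(ν-q)² · cm`
  have hsq : ((ν - q) * m) ^ 2 = (ν - q) ^ 2 * (m * m) := by ring
  rw [hsq] at hcheb
  have hνq2 : 0 < (ν - q) ^ 2 := by positivity
  have h1 : (m : ℝ) * (m * (bad.card : ℝ)) ≤ m * (cm * q * (1 - q) / (ν - q) ^ 2) := by
    rw [mul_div_assoc', le_div_iff₀ hνq2]
    nlinarith [hcheb]
  have h2 : (m : ℝ) * (bad.card : ℝ) ≤ cm * q * (1 - q) / (ν - q) ^ 2 := le_of_mul_le_mul_left h1 hmR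
  push_cast
  have h3 := mul_le_mul_of_nonneg_left h2 (Nat.cast_nonneg k)
  calc (k : ℝ) * m * (bad.card : ℝ) = k * (m * (bad.card : ℝ)) := by ring
    _ ≤ k * (cm * q * (1 - q) / (ν - q) ^ 2) := h3
    _ = k * (q * (1 - q) / (ν - q) ^ 2) * cm := by ring

/-- **Calibration — the constant section (crux notes B2 made a theorem).** For every `k ≥ 1`, density
`α > 0`, `η > 0`, tolerance `ν > 2^{-k}` and rate `c > 0`, for all large `n` (with `m = ⌊α n⌋₊`), the
constant all-`true` map realises the path event of `SolvableImpliesStableSection` / `NoStableSection`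
(ν-valid at every splice point, consecutive Hamming moves `≤ η n`) on at least an `e^{-cn}` fraction of
path tuples. So the CONCLUSION of the crux holds unconditionally in the regime `ν > 2^{-k}` (for all `k`,
not only `k ≥ k₀(ν)` as in `StableSectionEasyRegime`): the contentful regime is `ν ≤ 2^{-k}`.
Proof: the engine (`engine_count`) with `G = {≤ ν m all-negative clauses}` — Chebyshev (`cs_density`,
second moment `cs_sum_var`) gives `(k m) #Gᶜ ≤ k·2^{-k}(1-2^{-k})/(ν-2^{-k})² · #instances` — and no jumps
at all; then `stub_asymptotics`. -/
theorem conclusion_const_section (k : ℕ) (hk : 1 ≤ k) (α η ν : ℝ) (hα : 0 < α) (hη : 0 < η)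
    (hν : (1 / 2 : ℝ) ^ k < ν) (c : ℝ) (hc : 0 < c) :
    ∀ᶠ n : ℕ in Filter.atTop, ∀ m : ℕ, m = ⌊α * n⌋₊ →
      ∃ g : (Fin m → Fin k → Fin n × Bool) → (Fin n → Bool),
        Real.exp (-(c * n)) * Fintype.card (Fin (k + 1) → Fin m → Fin k → Fin n × Bool) ≤
        ((Finset.univ.filter fun Ψ : Fin (k + 1) → Fin m → Fin k → Fin n × Bool =>
          let P : Fin k → ℕ → Fin m → Fin k → Fin n × Bool :=
            fun r q a b => if (a : ℕ) * k + b < q then Ψ r.succ a b else Ψ r.castSucc a b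
          (∀ r : Fin k, ∀ q ≤ m * k, ((Finset.univ.filter fun i : Fin m =>
            ∀ j, g (P r q) (P r q i j).1 ≠ (P r q i j).2).card : ℝ) ≤ ν * m) ∧
          ∀ r : Fin k, ∀ q < m * k,
            (hammingDist (g (P r q)) (g (P r (q + 1))) : ℝ) ≤ η * n).card : ℝ) := by
  set pk : ℝ := (1 / 2 : ℝ) ^ k with hpk
  set A : ℝ := k * (pk * (1 - pk) / (ν - pk) ^ 2) + 1 with hAdef
  have hpk0 : 0 ≤ pk := by positivity
  have hpk1 : pk ≤ 1 := pow_le_one₀ (by norm_num) (by norm_num)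
  have hA : 0 < A := by
    have : 0 ≤ (k : ℝ) * (pk * (1 - pk) / (ν - pk) ^ 2) :=
      mul_nonneg (Nat.cast_nonneg k) (div_nonneg (mul_nonneg hpk0 (by linarith)) (sq_nonneg _))
    linarith
  filter_upwards [stub_asymptotics k hk α A c hα hA hc, Filter.eventually_ge_atTop 1] with n hasym hn1
  intro m hm
  obtain ⟨g, hg⟩ : ∃ g : (Fin m → Fin k → Fin n × Bool) → (Fin n → Bool), ∀ Φ, g Φ = fun _ => true :=
    ⟨fun _ _ => true, fun _ => rfl⟩
  refine ⟨g, ?_⟩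
  -- the all-negative clauses and their density `2^{-k}`
  set Bk : Finset (Fin k → Fin n × Bool) :=
    univ.filter fun cl => ∀ j, (cl j).2 = false with hBk
  haveI : Nonempty (Fin n × Bool) := ⟨(⟨0, hn1⟩, false)⟩
  have hC : 0 < Fintype.card (Fin k → Fin n × Bool) := Fintype.card_pos
  have hratio : (Bk.card : ℝ) / Fintype.card (Fin k → Fin n × Bool) = pk := by
    have h := Summit.PneNP.PneNP.Theorems.ssER_card_badClauses n k
    rw [div_eq_iff (by exact_mod_cast hC.ne'), hpk]
    have h' : ((Bk.card * 2 ^ k : ℕ) : ℝ) = Fintype.card (Fin k → Fin n × Bool) := by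
      rw [hBk]; exact_mod_cast h
    push_cast at h'
    rw [← h', one_div, inv_pow]
    field_simp
  -- the good set: at most `ν m` all-negative clauses
  set G : Finset (Fin m → Fin k → Fin n × Bool) := univ.filter fun Φ =>
    (((univ : Finset (Fin m)).filter fun i => Φ i ∈ Bk).card : ℝ) ≤ ν * m with hG
  have hGc : Gᶜ = univ.filter fun Φ : Fin m → Fin k → Fin n × Bool =>
      ¬ ((((univ : Finset (Fin m)).filter fun i => Φ i ∈ Bk).card : ℝ) ≤ ν * m) := by
    rw [hG, Finset.compl_filter]
  have hGbound : ((k * m : ℕ) : ℝ) * (Gᶜ.card : ℝ)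
      ≤ A * Fintype.card (Fin m → Fin k → Fin n × Bool) := by
    rw [hGc]
    have h := cs_density k m Bk hC ν (by rw [hratio]; exact hν)
    rw [hratio] at h
    refine h.trans ?_
    have hcardI : (Fintype.card (Fin m → Fin k → Fin n × Bool) : ℝ)
        = (Fintype.card (Fin k → Fin n × Bool) : ℝ) ^ m := by
      rw [Fintype.card_fun (α := Fin m), Fintype.card_fin]; push_cast; ring
    rw [hcardI]
    have hpos : (0 : ℝ) ≤ (Fintype.card (Fin k → Fin n × Bool) : ℝ) ^ m := by positivity
    nlinarith [hpos]
  -- no jumps: the section is constant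
  have hjump : (∑ a : Fin m, ∑ b : Fin k,
      (((Finset.univ : Finset ((Fin m → Fin k → Fin n × Bool) × (Fin n × Bool))).filter
        fun p => η * n < hammingDist (g p.1)
          (g (Function.update p.1 a (Function.update (p.1 a) b p.2)))).card : ℝ))
      ≤ A * (Fintype.card (Fin m → Fin k → Fin n × Bool) * (2 * n)) := by
    have hzero : (∑ a : Fin m, ∑ b : Fin k,
        (((Finset.univ : Finset ((Fin m → Fin k → Fin n × Bool) × (Fin n × Bool))).filter
          fun p => η * n < hammingDist (g p.1)
            (g (Function.update p.1 a (Function.update (p.1 a) b p.2)))).card : ℝ)) = 0 := by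
      refine Finset.sum_eq_zero fun a _ => Finset.sum_eq_zero fun b _ => ?_
      rw [Nat.cast_eq_zero, Finset.card_eq_zero, Finset.filter_eq_empty_iff]
      intro p _
      rw [hg, hg, hammingDist_self, Nat.cast_zero, not_lt]
      positivity
    rw [hzero]
    positivity
  have hE := engine_count k m n hn1 η A hη.le hA.le g G hGbound hjump
  subst hm
  have hpaths : (Fintype.card (Fin (k + 1) → Fin ⌊α * n⌋₊ → Fin k → Fin n × Bool) : ℝ) =
      (2 * n) ^ (⌊α * n⌋₊ * k * (k + 1)) := by
    rw [eng_card_paths]; push_cast; ring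
  -- the engine's event implies the crux's event
  have hmono : ((univ : Finset (Fin (k + 1) → Fin ⌊α * n⌋₊ → Fin k → Fin n × Bool)).filter fun Ψ =>
          (∀ r : Fin k, ∀ q ≤ ⌊α * n⌋₊ * k,
            (fun (a : Fin ⌊α * n⌋₊) (b : Fin k) =>
              if (a : ℕ) * k + b < q then Ψ r.succ a b else Ψ r.castSucc a b) ∈ G) ∧
          ∀ r : Fin k, ∀ q < ⌊α * n⌋₊ * k,
            (hammingDist
              (g fun (a : Fin ⌊α * n⌋₊) (b : Fin k) =>
                  if (a : ℕ) * k + b < q then Ψ r.succ a b else Ψ r.castSucc a b)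
              (g fun (a : Fin ⌊α * n⌋₊) (b : Fin k) =>
                  if (a : ℕ) * k + b < q + 1 then Ψ r.succ a b else Ψ r.castSucc a b) : ℝ)
              ≤ η * n).card ≤
      ((univ : Finset (Fin (k + 1) → Fin ⌊α * n⌋₊ → Fin k → Fin n × Bool)).filter fun Ψ =>
        let P : Fin k → ℕ → Fin ⌊α * n⌋₊ → Fin k → Fin n × Bool :=
          fun r q a b => if (a : ℕ) * k + b < q then Ψ r.succ a b else Ψ r.castSucc a b
        (∀ r : Fin k, ∀ q ≤ ⌊α * n⌋₊ * k, (((Finset.univ : Finset (Fin ⌊α * n⌋₊)).filter fun i =>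
          ∀ j, g (P r q) (P r q i j).1 ≠ (P r q i j).2).card : ℝ) ≤ ν * ⌊α * n⌋₊) ∧
        ∀ r : Fin k, ∀ q < ⌊α * n⌋₊ * k,
          (hammingDist (g (P r q)) (g (P r (q + 1))) : ℝ) ≤ η * n).card := by
    refine Finset.card_le_card fun Ψ hΨ => ?_
    simp only [Finset.mem_filter, Finset.mem_univ, true_and] at hΨ ⊢
    obtain ⟨hin, hjmp⟩ := hΨ
    refine ⟨fun r q hq => ?_, fun r q hq => hjmp r q hq⟩
    have hmem := hin r q hq
    rw [hG, Finset.mem_filter] at hmem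
    refine le_of_eq_of_le ?_ hmem.2
    congr 2
    refine Finset.filter_congr fun i _ => ?_
    simp [hBk, hg]
  have hmono' := (Nat.cast_le (α := ℝ)).2 hmono
  rw [hpaths]
  linarith [hasym, hE, hmono']

/-- **The crux restricted to `ν > 2^{-k}` is a theorem** (hypothesis unused): for every `k ≥ 1`,
`α, η > 0`, `ν > 2^{-k}`, ANY hypothesis `H` (in particular efficient solvability) implies the
conclusion of `SolvableImpliesStableSection` at `(k, α, η, ν)`. -/
theorem solvableImpliesStableSection_of_nu_gt (k : ℕ) (hk : 1 ≤ k) (α η ν : ℝ) (hα : 0 < α)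
    (hη : 0 < η) (hν : (1 / 2 : ℝ) ^ k < ν) (c : ℝ) (hc : 0 < c) :
    ∃ᶠ n : ℕ in Filter.atTop, ∀ m : ℕ, m = ⌊α * n⌋₊ →
      ∃ g : (Fin m → Fin k → Fin n × Bool) → (Fin n → Bool),
        Real.exp (-(c * n)) * Fintype.card (Fin (k + 1) → Fin m → Fin k → Fin n × Bool) ≤
        ((Finset.univ.filter fun Ψ : Fin (k + 1) → Fin m → Fin k → Fin n × Bool =>
          let P : Fin k → ℕ → Fin m → Fin k → Fin n × Bool :=
            fun r q a b => if (a : ℕ) * k + b < q then Ψ r.succ a b else Ψ r.castSucc a b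
          (∀ r : Fin k, ∀ q ≤ m * k, ((Finset.univ.filter fun i : Fin m =>
            ∀ j, g (P r q) (P r q i j).1 ≠ (P r q i j).2).card : ℝ) ≤ ν * m) ∧
          ∀ r : Fin k, ∀ q < m * k,
            (hammingDist (g (P r q)) (g (P r (q + 1))) : ℝ) ≤ η * n).card : ℝ) :=
  (conclusion_const_section k hk α η ν hα hη hν c hc).frequently

end ConstSection

end Summit.PneNP.PneNP.Cruxes.SolvableImpliesStableSection.Sketch
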